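import Summits.Ventures.QEC.Census.CertCoverProducers
import Summits.Ventures.QEC.Census.BB.A1s_n192_k4_0fa3ae82.CoreDefs
import HarnessLib

set_option Elab.async false
set_option maxRecDepth 200000

/-!
# `[[192,4,18]]` one-level cover certificate — ASSEMBLY side: translation automorphisms 24–47 are cover-compatible row-map automorphisms
(`permCompatOK` with `ePermqs[i]` downstairs; `rowMapOKL` for `H^X` and `H^Z`, type-12 lockstep form). Theorems only; KERNEL.
-/

namespace Summit.Ventures.QEC.Census.A1s_n192_k4_0fa3ae82

open Matrix Summit.Ventures.QEC.Census Literature.InformationTheory.QuantumCodes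

/-- Automorphism 24 (translation `(1, 0)`): cover-compatible with `ePermqs[24]`, row-map automorphism of `H^X` and `H^Z`. -/
theorem aut24_ok : cov.permCompatOK perm24 (ePermqs.getD 24 []) = true ∧ rowMapOKL hx perm24 rows24 = true ∧ rowMapOKL hz perm24 rows24 = true := by
  refine ⟨?_, ?_, ?_⟩ <;> decide +kernel

/-- Automorphism 25 (translation `(1, 1)`): cover-compatible with `ePermqs[25]`, row-map automorphism of `H^X` and `H^Z`. -/
theorem aut25_ok : cov.permCompatOK perm25 (ePermqs.getD 25 []) = true ∧ rowMapOKL hx perm25 rows25 = true ∧ rowMapOKL hz perm25 rows25 = true := by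
  refine ⟨?_, ?_, ?_⟩ <;> decide +kernel

/-- Automorphism 26 (translation `(1, 2)`): cover-compatible with `ePermqs[26]`, row-map automorphism of `H^X` and `H^Z`. -/
theorem aut26_ok : cov.permCompatOK perm26 (ePermqs.getD 26 []) = true ∧ rowMapOKL hx perm26 rows26 = true ∧ rowMapOKL hz perm26 rows26 = true := by
  refine ⟨?_, ?_, ?_⟩ <;> decide +kernel

/-- Automorphism 27 (translation `(1, 3)`): cover-compatible with `ePermqs[27]`, row-map automorphism of `H^X` and `H^Z`. -/
theorem aut27_ok : cov.permCompatOK perm27 (ePermqs.getD 27 []) = true ∧ rowMapOKL hx perm27 rows27 = true ∧ rowMapOKL hz perm27 rows27 = true := by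
  refine ⟨?_, ?_, ?_⟩ <;> decide +kernel

/-- Automorphism 28 (translation `(1, 4)`): cover-compatible with `ePermqs[28]`, row-map automorphism of `H^X` and `H^Z`. -/
theorem aut28_ok : cov.permCompatOK perm28 (ePermqs.getD 28 []) = true ∧ rowMapOKL hx perm28 rows28 = true ∧ rowMapOKL hz perm28 rows28 = true := by
  refine ⟨?_, ?_, ?_⟩ <;> decide +kernel

/-- Automorphism 29 (translation `(1, 5)`): cover-compatible with `ePermqs[29]`, row-map automorphism of `H^X` and `H^Z`. -/
theorem aut29_ok : cov.permCompatOK perm29 (ePermqs.getD 29 []) = true ∧ rowMapOKL hx perm29 rows29 = true ∧ rowMapOKL hz perm29 rows29 = true := by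
  refine ⟨?_, ?_, ?_⟩ <;> decide +kernel

/-- Automorphism 30 (translation `(1, 6)`): cover-compatible with `ePermqs[30]`, row-map automorphism of `H^X` and `H^Z`. -/
theorem aut30_ok : cov.permCompatOK perm30 (ePermqs.getD 30 []) = true ∧ rowMapOKL hx perm30 rows30 = true ∧ rowMapOKL hz perm30 rows30 = true := by
  refine ⟨?_, ?_, ?_⟩ <;> decide +kernel

/-- Automorphism 31 (translation `(1, 7)`): cover-compatible with `ePermqs[31]`, row-map automorphism of `H^X` and `H^Z`. -/
theorem aut31_ok : cov.permCompatOK perm31 (ePermqs.getD 31 []) = true ∧ rowMapOKL hx perm31 rows31 = true ∧ rowMapOKL hz perm31 rows31 = true := by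
  refine ⟨?_, ?_, ?_⟩ <;> decide +kernel

/-- Automorphism 32 (translation `(1, 8)`): cover-compatible with `ePermqs[32]`, row-map automorphism of `H^X` and `H^Z`. -/
theorem aut32_ok : cov.permCompatOK perm32 (ePermqs.getD 32 []) = true ∧ rowMapOKL hx perm32 rows32 = true ∧ rowMapOKL hz perm32 rows32 = true := by
  refine ⟨?_, ?_, ?_⟩ <;> decide +kernel

/-- Automorphism 33 (translation `(1, 9)`): cover-compatible with `ePermqs[33]`, row-map automorphism of `H^X` and `H^Z`. -/
theorem aut33_ok : cov.permCompatOK perm33 (ePermqs.getD 33 []) = true ∧ rowMapOKL hx perm33 rows33 = true ∧ rowMapOKL hz perm33 rows33 = true := by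
  refine ⟨?_, ?_, ?_⟩ <;> decide +kernel

/-- Automorphism 34 (translation `(1, 10)`): cover-compatible with `ePermqs[34]`, row-map automorphism of `H^X` and `H^Z`. -/
theorem aut34_ok : cov.permCompatOK perm34 (ePermqs.getD 34 []) = true ∧ rowMapOKL hx perm34 rows34 = true ∧ rowMapOKL hz perm34 rows34 = true := by
  refine ⟨?_, ?_, ?_⟩ <;> decide +kernel

/-- Automorphism 35 (translation `(1, 11)`): cover-compatible with `ePermqs[35]`, row-map automorphism of `H^X` and `H^Z`. -/
theorem aut35_ok : cov.permCompatOK perm35 (ePermqs.getD 35 []) = true ∧ rowMapOKL hx perm35 rows35 = true ∧ rowMapOKL hz perm35 rows35 = true := by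
  refine ⟨?_, ?_, ?_⟩ <;> decide +kernel

/-- Automorphism 36 (translation `(1, 12)`): cover-compatible with `ePermqs[36]`, row-map automorphism of `H^X` and `H^Z`. -/
theorem aut36_ok : cov.permCompatOK perm36 (ePermqs.getD 36 []) = true ∧ rowMapOKL hx perm36 rows36 = true ∧ rowMapOKL hz perm36 rows36 = true := by
  refine ⟨?_, ?_, ?_⟩ <;> decide +kernel

/-- Automorphism 37 (translation `(1, 13)`): cover-compatible with `ePermqs[37]`, row-map automorphism of `H^X` and `H^Z`. -/
theorem aut37_ok : cov.permCompatOK perm37 (ePermqs.getD 37 []) = true ∧ rowMapOKL hx perm37 rows37 = true ∧ rowMapOKL hz perm37 rows37 = true := by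
  refine ⟨?_, ?_, ?_⟩ <;> decide +kernel

/-- Automorphism 38 (translation `(1, 14)`): cover-compatible with `ePermqs[38]`, row-map automorphism of `H^X` and `H^Z`. -/
theorem aut38_ok : cov.permCompatOK perm38 (ePermqs.getD 38 []) = true ∧ rowMapOKL hx perm38 rows38 = true ∧ rowMapOKL hz perm38 rows38 = true := by
  refine ⟨?_, ?_, ?_⟩ <;> decide +kernel

/-- Automorphism 39 (translation `(1, 15)`): cover-compatible with `ePermqs[39]`, row-map automorphism of `H^X` and `H^Z`. -/
theorem aut39_ok : cov.permCompatOK perm39 (ePermqs.getD 39 []) = true ∧ rowMapOKL hx perm39 rows39 = true ∧ rowMapOKL hz perm39 rows39 = true := by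
  refine ⟨?_, ?_, ?_⟩ <;> decide +kernel

/-- Automorphism 40 (translation `(1, 16)`): cover-compatible with `ePermqs[40]`, row-map automorphism of `H^X` and `H^Z`. -/
theorem aut40_ok : cov.permCompatOK perm40 (ePermqs.getD 40 []) = true ∧ rowMapOKL hx perm40 rows40 = true ∧ rowMapOKL hz perm40 rows40 = true := by
  refine ⟨?_, ?_, ?_⟩ <;> decide +kernel

/-- Automorphism 41 (translation `(1, 17)`): cover-compatible with `ePermqs[41]`, row-map automorphism of `H^X` and `H^Z`. -/
theorem aut41_ok : cov.permCompatOK perm41 (ePermqs.getD 41 []) = true ∧ rowMapOKL hx perm41 rows41 = true ∧ rowMapOKL hz perm41 rows41 = true := by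
  refine ⟨?_, ?_, ?_⟩ <;> decide +kernel

/-- Automorphism 42 (translation `(1, 18)`): cover-compatible with `ePermqs[42]`, row-map automorphism of `H^X` and `H^Z`. -/
theorem aut42_ok : cov.permCompatOK perm42 (ePermqs.getD 42 []) = true ∧ rowMapOKL hx perm42 rows42 = true ∧ rowMapOKL hz perm42 rows42 = true := by
  refine ⟨?_, ?_, ?_⟩ <;> decide +kernel

/-- Automorphism 43 (translation `(1, 19)`): cover-compatible with `ePermqs[43]`, row-map automorphism of `H^X` and `H^Z`. -/
theorem aut43_ok : cov.permCompatOK perm43 (ePermqs.getD 43 []) = true ∧ rowMapOKL hx perm43 rows43 = true ∧ rowMapOKL hz perm43 rows43 = true := by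
  refine ⟨?_, ?_, ?_⟩ <;> decide +kernel

/-- Automorphism 44 (translation `(1, 20)`): cover-compatible with `ePermqs[44]`, row-map automorphism of `H^X` and `H^Z`. -/
theorem aut44_ok : cov.permCompatOK perm44 (ePermqs.getD 44 []) = true ∧ rowMapOKL hx perm44 rows44 = true ∧ rowMapOKL hz perm44 rows44 = true := by
  refine ⟨?_, ?_, ?_⟩ <;> decide +kernel

/-- Automorphism 45 (translation `(1, 21)`): cover-compatible with `ePermqs[45]`, row-map automorphism of `H^X` and `H^Z`. -/
theorem aut45_ok : cov.permCompatOK perm45 (ePermqs.getD 45 []) = true ∧ rowMapOKL hx perm45 rows45 = true ∧ rowMapOKL hz perm45 rows45 = true := by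
  refine ⟨?_, ?_, ?_⟩ <;> decide +kernel

/-- Automorphism 46 (translation `(1, 22)`): cover-compatible with `ePermqs[46]`, row-map automorphism of `H^X` and `H^Z`. -/
theorem aut46_ok : cov.permCompatOK perm46 (ePermqs.getD 46 []) = true ∧ rowMapOKL hx perm46 rows46 = true ∧ rowMapOKL hz perm46 rows46 = true := by
  refine ⟨?_, ?_, ?_⟩ <;> decide +kernel

/-- Automorphism 47 (translation `(1, 23)`): cover-compatible with `ePermqs[47]`, row-map automorphism of `H^X` and `H^Z`. -/
theorem aut47_ok : cov.permCompatOK perm47 (ePermqs.getD 47 []) = true ∧ rowMapOKL hx perm47 rows47 = true ∧ rowMapOKL hz perm47 rows47 = true := by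
  refine ⟨?_, ?_, ?_⟩ <;> decide +kernel


end Summit.Ventures.QEC.Census.A1s_n192_k4_0fa3ae82
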